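import Literature.Probability.LatticeModels.KCGaugedSections
import Literature.Probability.LatticeModels.SHolomorphicPrimitiveLaplacian
import HarnessLib

/-!
# Lemma 3.8 for spinor sections: local gauges and the signs of the Laplacian of `H = Re ∫ F²`

Topic `Literature/Probability/LatticeModels`. Chelkak–Hongler–Izyurov 2015, Remark 3.9 / Prop. 3.6:
the primitive `H` of the square of an s-holomorphic SPINOR (a section which is s-holomorphic at some
corners and has opposite projections — `IsAntiAt` — at the others, the seam) is sub- and super-harmonic
exactly as in Smirnov's Lemma 3.8, because the increments `|F(c)|²` are sign-blind and, around any one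
site or plaquette with an EVEN number of seam corners, a local bond gauge `χ = ±1` turns the section
into an honest s-holomorphic function (to which `sum_vertexStep_eq_neg_norm_sq` /
`sum_faceStep_eq_norm_sq` apply). This file proves exactly that:

* `CompatAt F q s` (`s = 1` and `IsSHolAt`, or `s = -1` and `IsAntiAt`), `CompatAt.cornerFlux_eq`,
  `CompatAt.gauge`, `cornerFlux_sign_mul`;
* bond gauges keyed by `x + y` (`keyGauge`), the explicit local gauges `siteGauge`, `faceGauge` and
  their values on the eight bonds around a site / a plaquette;
* **`sum_vertexStep_nonpos_of_compat`**, **`sum_faceStep_nonneg_of_compat`**: Lemma 3.8 for sections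
  with sign data of even parity around the site / plaquette (a corner where BOTH projections vanish is
  compatible with either sign, which is how the source corner of `F_{[Ω_δ,a]} - F_{[ℂ_δ,a]}` is used);
* `cornerFlux_cycle_of_compat`, `isCornerClosedOn_cornerFlux_of_compat` (closedness of the flux form,
  Lemma 3.6, needs compatibility at the two arriving corners only);
* `IsPrimitivePair.latticeLaplacian_white_nonpos_of_compat` / `…_black_nonneg_of_compat`.

Everything is proved; no named fact.

## References

* S. Smirnov, Ann. of Math. 172 (2010), Lemma 3.6, Lemma 3.8 [Smirnov2010].
* D. Chelkak, C. Hongler, K. Izyurov, Ann. of Math. 181 (2015), Prop. 3.6, Remark 3.9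
  [ChelkakHonglerIzyurovAnnals2015].
-/

noncomputable section

namespace Literature.Probability.LatticeModels

open Complex Finset

/-! ### Compatibility of a section with a sign at a corner -/

/-- `F` is **compatible with the sign `s` at the corner `q`**: `s = 1` and `F` is s-holomorphic there,
or `s = -1` and `F` has opposite projections there. [cite: ChelkakHonglerIzyurovAnnals2015, Remark 3.9] -/
def CompatAt (F : MedialVertex → ℂ) (q : Site 2 × Fin 4) (s : ℝ) : Prop :=
  (s = 1 ∧ IsSHolAt F q) ∨ (s = -1 ∧ IsAntiAt F q)

/-- Bookkeeping (`IsSHolAt.compatAt`). [folklore] -/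
theorem IsSHolAt.compatAt {F : MedialVertex → ℂ} {q : Site 2 × Fin 4} (h : IsSHolAt F q) : CompatAt F q 1 :=
  Or.inl ⟨rfl, h⟩

/-- Bookkeeping (`IsAntiAt.compatAt`). [folklore] -/
theorem IsAntiAt.compatAt {F : MedialVertex → ℂ} {q : Site 2 × Fin 4} (h : IsAntiAt F q) : CompatAt F q (-1) :=
  Or.inr ⟨rfl, h⟩

namespace CompatAt

variable {F : MedialVertex → ℂ} {q : Site 2 × Fin 4} {s : ℝ}

/-- The sign is `±1`. [folklore] -/
theorem pm (h : CompatAt F q s) : s = 1 ∨ s = -1 := by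
  rcases h with ⟨h, -⟩ | ⟨h, -⟩
  · exact Or.inl h
  · exact Or.inr h

/-- A compatible corner lets the flux be read at the target bond (sign-blind). [cite: Smirnov2010, Def. 3.1] -/
theorem cornerFlux_eq (h : CompatAt F q s) : cornerFlux F q = ‖projLine (cornerLine q.1 (cFace q)) (F (cTgt q))‖ ^ 2 := by
  rcases h with ⟨-, h⟩ | ⟨-, h⟩
  · exact h.cornerFlux_eq
  · unfold cornerFlux
    rw [h, norm_neg]

/-- **Gauging a compatible corner**: if the bond sign `χ` has `χ(src) χ(tgt) = s` then `χ F` is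
s-holomorphic at the corner. [folklore] -/
theorem gauge {χ : MedialVertex → ℝ} (hχ : χ (cSrc q) = 1 ∨ χ (cSrc q) = -1) (hχ' : χ (cTgt q) = 1 ∨ χ (cTgt q) = -1)
    (h : CompatAt F q (χ (cSrc q) * χ (cTgt q))) : IsSHolAt (fun e => (χ e : ℂ) * F e) q := by
  have hpm := pm_eq_of_mul_eq hχ hχ'
  rcases h with ⟨h1, hF⟩ | ⟨h1, hF⟩
  · exact (isSHolAt_sign_mul_iff hχ (hpm.1 h1).symm).2 hF
  · have hop : χ (cTgt q) = -χ (cSrc q) := by rw [hpm.2 h1]; ring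
    exact ((isSHolAt_sign_mul_iff_anti hχ hop).1).2 hF

end CompatAt

/-- Fluxes are gauge invariant. [folklore] -/
theorem cornerFlux_sign_mul {χ : MedialVertex → ℝ} {F : MedialVertex → ℂ} {q : Site 2 × Fin 4}
    (hχ : χ (cSrc q) = 1 ∨ χ (cSrc q) = -1) : cornerFlux (fun e => (χ e : ℂ) * F e) q = cornerFlux F q := by
  unfold cornerFlux
  rw [projLine_ofReal_mul_right, norm_mul]
  rcases hχ with h | h <;> rw [h] <;> norm_num

/-! ### Bond gauges keyed by the sum of the endpoints -/

/-- A bond function from a site function through the key `x + y` of the bond `{x, y}` (distinct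
lattice bonds have distinct keys). [folklore] -/
def keyGauge (μ : Site 2 → ℝ) : MedialVertex → ℝ :=
  Sym2.lift ⟨fun x y => μ (x + y), fun x y => by show μ (x + y) = μ (y + x); rw [add_comm]⟩

/-- Bookkeeping (`keyGauge_mk`). [folklore] -/
@[simp] theorem keyGauge_mk (μ : Site 2 → ℝ) (x y : Site 2) : keyGauge μ s(x, y) = μ (x + y) := rfl

/-- The outer key offsets around a site: `2 e_k + e_{k+1}`. [folklore] -/
def siteOutOff (k : Fin 4) : Site 2 := cornerUnit k + cornerUnit k + cornerUnit (k + 1)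

/-- Bookkeeping (`siteOutOff_injective`). [folklore] -/
theorem siteOutOff_injective : Function.Injective siteOutOff := by decide

/-- Bookkeeping (`siteOutOff_ne_cornerUnit`). [folklore] -/
theorem siteOutOff_ne_cornerUnit (k j : Fin 4) : siteOutOff k ≠ cornerUnit j := by
  revert k j; decide

/-- The local gauge data around a site: `c k` on the bond `e_k`, `d k` on the outer bond of the
arriving corner at `u + e_k`, `1` elsewhere. [folklore] -/
def siteGaugeFun (c d : Fin 4 → ℝ) (w : Site 2) : ℝ :=
  if h : ∃ k, w = cornerUnit k then c h.choose
  else if h' : ∃ k, w = siteOutOff k then d h'.choose else 1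

/-- Bookkeeping (`siteGaugeFun_cornerUnit`). [folklore] -/
theorem siteGaugeFun_cornerUnit (c d : Fin 4 → ℝ) (k : Fin 4) : siteGaugeFun c d (cornerUnit k) = c k := by
  have h : ∃ j, cornerUnit k = cornerUnit j := ⟨k, rfl⟩
  rw [siteGaugeFun, dif_pos h, cornerUnit_injective h.choose_spec.symm]

/-- Bookkeeping (`siteGaugeFun_siteOutOff`). [folklore] -/
theorem siteGaugeFun_siteOutOff (c d : Fin 4 → ℝ) (k : Fin 4) : siteGaugeFun c d (siteOutOff k) = d k := by
  have h : ¬ ∃ j, siteOutOff k = cornerUnit j := fun ⟨j, hj⟩ => siteOutOff_ne_cornerUnit k j hj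
  have h' : ∃ j, siteOutOff k = siteOutOff j := ⟨k, rfl⟩
  rw [siteGaugeFun, dif_neg h, dif_pos h', siteOutOff_injective h'.choose_spec.symm]

/-- Bookkeeping (`siteGaugeFun_cases`). [folklore] -/
theorem siteGaugeFun_cases {c d : Fin 4 → ℝ} (hc : ∀ k, c k = 1 ∨ c k = -1) (hd : ∀ k, d k = 1 ∨ d k = -1) (w : Site 2) :
    siteGaugeFun c d w = 1 ∨ siteGaugeFun c d w = -1 := by
  unfold siteGaugeFun
  split_ifs
  · exact hc _
  · exact hd _
  · exact Or.inl rfl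

/-- **The local gauge around the site `u`.** [folklore] -/
def siteGauge (u : Site 2) (c d : Fin 4 → ℝ) : MedialVertex → ℝ :=
  keyGauge fun x => siteGaugeFun c d (x - u - u)

/-- Bookkeeping (`siteGauge_cases`). [folklore] -/
theorem siteGauge_cases (u : Site 2) {c d : Fin 4 → ℝ} (hc : ∀ k, c k = 1 ∨ c k = -1) (hd : ∀ k, d k = 1 ∨ d k = -1)
    (e : MedialVertex) : siteGauge u c d e = 1 ∨ siteGauge u c d e = -1 := by
  induction e using Sym2.ind with
  | h x y => simp only [siteGauge, keyGauge_mk]; exact siteGaugeFun_cases hc hd _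

/-- Bookkeeping (`cornerUnit_add_add_two`). [folklore] -/
theorem cornerUnit_add_add_two (k : Fin 4) : cornerUnit k + cornerUnit k + cornerUnit (k + 1 + 1) = cornerUnit k := by
  fin_cases k <;> decide

/-- The values of the site gauge on the eight bonds around `u`. [folklore] -/
theorem siteGauge_values (u : Site 2) (c d : Fin 4 → ℝ) (k : Fin 4) :
    siteGauge u c d (cSrc (u, k)) = c k ∧ siteGauge u c d (cTgt (u, k)) = c (k + 1) ∧
    siteGauge u c d (cSrc (u + cornerUnit k, k + 1)) = d k ∧ siteGauge u c d (cTgt (u + cornerUnit k, k + 1)) = c k := by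
  simp only [siteGauge, cSrc, cTgt, keyGauge_mk]
  refine ⟨?_, ?_, ?_, ?_⟩
  · rw [show u + (u + cornerUnit k) - u - u = cornerUnit k by abel, siteGaugeFun_cornerUnit]
  · rw [show u + (u + cornerUnit (k + 1)) - u - u = cornerUnit (k + 1) by abel, siteGaugeFun_cornerUnit]
  · rw [show u + cornerUnit k + (u + cornerUnit k + cornerUnit (k + 1)) - u - u = siteOutOff k by rw [siteOutOff]; abel,
      siteGaugeFun_siteOutOff]
  · rw [show u + cornerUnit k + (u + cornerUnit k + cornerUnit (k + 1 + 1)) - u - u =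
      cornerUnit k + cornerUnit k + cornerUnit (k + 1 + 1) by abel, cornerUnit_add_add_two, siteGaugeFun_cornerUnit]

/-- Squares of signs. [folklore] -/
theorem pm_sq {a : ℝ} (h : a = 1 ∨ a = -1) : a * a = 1 := by
  rcases h with rfl | rfl <;> norm_num

/-- **Lemma 3.8 at a site for a section** (even parity of the seam corners around `u`):
`∑_k (Φ(u,k) - Φ(u + e_k, k+1)) ≤ 0`, i.e. `Δ H_w (u) ≤ 0` for any primitive. [cite: Smirnov2010, Lemma 3.8; ChelkakHonglerIzyurovAnnals2015, Remark 3.9] -/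
theorem sum_vertexStep_nonpos_of_compat (F : MedialVertex → ℂ) (u : Site 2) {s s' : Fin 4 → ℝ}
    (hin : ∀ k, CompatAt F (u, k) (s k)) (hout : ∀ k, CompatAt F (u + cornerUnit k, k + 1) (s' k))
    (hpar : s 0 * s 1 * s 2 * s 3 = 1) :
    ∑ k : Fin 4, (cornerFlux F (u, k) - cornerFlux F (u + cornerUnit k, k + 1)) ≤ 0 := by
  have hs := fun k => (hin k).pm
  have hs' := fun k => (hout k).pm
  -- the gauge data
  obtain ⟨c, hc⟩ : ∃ c : Fin 4 → ℝ, c = ![1, s 0, s 0 * s 1, s 0 * s 1 * s 2] := ⟨_, rfl⟩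
  have c0 : c 0 = 1 := by rw [hc]; rfl
  have c1 : c 1 = s 0 := by rw [hc]; rfl
  have c2 : c 2 = s 0 * s 1 := by rw [hc]; rfl
  have c3 : c 3 = s 0 * s 1 * s 2 := by rw [hc]; rfl
  have hcpm : ∀ k, c k = 1 ∨ c k = -1 := by
    intro k
    fin_cases k
    · exact Or.inl c0
    · rw [show c ⟨1, by norm_num⟩ = s 0 from c1]; exact hs 0
    · rw [show c ⟨2, by norm_num⟩ = s 0 * s 1 from c2]; exact pm_mul (hs 0) (hs 1)
    · rw [show c ⟨3, by norm_num⟩ = s 0 * s 1 * s 2 from c3]; exact pm_mul (pm_mul (hs 0) (hs 1)) (hs 2)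
  obtain ⟨d, hd⟩ : ∃ d : Fin 4 → ℝ, d = fun k => s' k * c k := ⟨_, rfl⟩
  have hdpm : ∀ k, d k = 1 ∨ d k = -1 := fun k => by rw [hd]; exact pm_mul (hs' k) (hcpm k)
  -- the products around the inner corners
  have q0 := pm_sq (hs 0)
  have q1 := pm_sq (hs 1)
  have q2 := pm_sq (hs 2)
  have q3 := pm_sq (hs 3)
  have hprod : ∀ k, c k * c (k + 1) = s k := by
    intro k
    fin_cases k
    · show c 0 * c 1 = s 0
      rw [c0, c1, one_mul]
    · show c 1 * c 2 = s 1
      rw [c1, c2]; linear_combination s 1 * q0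
    · show c 2 * c 3 = s 2
      rw [c2, c3]; linear_combination (s 1 * s 1 * s 2) * q0 + s 2 * q1
    · show c 3 * c 0 = s 3
      rw [c3, c0]; linear_combination (-(s 0 * s 1 * s 2)) * q3 + s 3 * hpar
  have hprod' : ∀ k, d k * c k = s' k := by
    intro k; rw [hd]; simp only; rw [mul_assoc, pm_sq (hcpm k), mul_one]
  -- gauge
  obtain ⟨χ, hχ⟩ : ∃ χ : MedialVertex → ℝ, χ = siteGauge u c d := ⟨_, rfl⟩
  have hχpm : ∀ e, χ e = 1 ∨ χ e = -1 := by rw [hχ]; exact siteGauge_cases u hcpm hdpm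
  have hvals := siteGauge_values u c d
  rw [← hχ] at hvals
  have hh : ∀ k, IsSHolAt (fun e => (χ e : ℂ) * F e) (u, k) := by
    intro k
    refine CompatAt.gauge (hχpm _) (hχpm _) ?_
    rw [(hvals k).1, (hvals k).2.1, hprod k]; exact hin k
  have hh' : ∀ k, IsSHolAt (fun e => (χ e : ℂ) * F e) (u + cornerUnit k, k + 1) := by
    intro k
    refine CompatAt.gauge (hχpm _) (hχpm _) ?_
    rw [(hvals k).2.2.1, (hvals k).2.2.2, hprod' k]; exact hout k
  have key := sum_vertexStep_eq_neg_norm_sq (fun e => (χ e : ℂ) * F e) u hh hh'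
  have hsum : ∑ k : Fin 4, (cornerFlux F (u, k) - cornerFlux F (u + cornerUnit k, k + 1)) =
      ∑ k : Fin 4, (cornerFlux (fun e => (χ e : ℂ) * F e) (u, k) - cornerFlux (fun e => (χ e : ℂ) * F e) (u + cornerUnit k, k + 1)) := by
    refine Finset.sum_congr rfl fun k _ => ?_
    rw [cornerFlux_sign_mul (hχpm _), cornerFlux_sign_mul (hχpm _)]
  rw [hsum, key]
  exact neg_nonpos.2 (sq_nonneg _)

/-! ### Around a plaquette -/

/-- The side key offsets of a plaquette: `2 cornerOff j + e_j`. [folklore] -/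
def faceSideOff (j : Fin 4) : Site 2 := cornerOff j + cornerOff j + cornerUnit j

/-- The outer key offsets of a plaquette: `2 cornerOff j + e_{j+3}`. [folklore] -/
def faceOutOff (j : Fin 4) : Site 2 := cornerOff j + cornerOff j + cornerUnit (j + 3)

/-- Bookkeeping (`faceSideOff_injective`). [folklore] -/
theorem faceSideOff_injective : Function.Injective faceSideOff := by decide

/-- Bookkeeping (`faceOutOff_injective`). [folklore] -/
theorem faceOutOff_injective : Function.Injective faceOutOff := by decide

/-- Bookkeeping (`faceOutOff_ne_faceSideOff`). [folklore] -/
theorem faceOutOff_ne_faceSideOff (k j : Fin 4) : faceOutOff k ≠ faceSideOff j := by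
  revert k j; decide

/-- The key of the previous side, seen from the corner `j`: `2 cornerOff j + e_{j+1} = faceSideOff (j + 3)`. [folklore] -/
theorem faceSideOff_prev (j : Fin 4) : cornerOff j + cornerOff j + cornerUnit (j + 1) = faceSideOff (j + 3) := by
  fin_cases j <;> decide

/-- The key of the side `j`, seen from the arriving corner `(v_j, j + 3)`: `e_{j+3+1} = e_j`. [folklore] -/
theorem faceSideOff_self (j : Fin 4) : cornerOff j + cornerOff j + cornerUnit (j + 3 + 1) = faceSideOff j := by
  fin_cases j <;> decide

/-- The local gauge data around a plaquette: `c j` on the side `E_j`, `d j` on the outer bond of the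
arriving corner at `v_j`, `1` elsewhere. [folklore] -/
def faceGaugeFun (c d : Fin 4 → ℝ) (w : Site 2) : ℝ :=
  if h : ∃ j, w = faceSideOff j then c h.choose
  else if h' : ∃ j, w = faceOutOff j then d h'.choose else 1

/-- Bookkeeping (`faceGaugeFun_side`). [folklore] -/
theorem faceGaugeFun_side (c d : Fin 4 → ℝ) (j : Fin 4) : faceGaugeFun c d (faceSideOff j) = c j := by
  have h : ∃ i, faceSideOff j = faceSideOff i := ⟨j, rfl⟩
  rw [faceGaugeFun, dif_pos h, faceSideOff_injective h.choose_spec.symm]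

/-- Bookkeeping (`faceGaugeFun_out`). [folklore] -/
theorem faceGaugeFun_out (c d : Fin 4 → ℝ) (j : Fin 4) : faceGaugeFun c d (faceOutOff j) = d j := by
  have h : ¬ ∃ i, faceOutOff j = faceSideOff i := fun ⟨i, hi⟩ => faceOutOff_ne_faceSideOff j i hi
  have h' : ∃ i, faceOutOff j = faceOutOff i := ⟨j, rfl⟩
  rw [faceGaugeFun, dif_neg h, dif_pos h', faceOutOff_injective h'.choose_spec.symm]

/-- Bookkeeping (`faceGaugeFun_cases`). [folklore] -/
theorem faceGaugeFun_cases {c d : Fin 4 → ℝ} (hc : ∀ k, c k = 1 ∨ c k = -1) (hd : ∀ k, d k = 1 ∨ d k = -1) (w : Site 2) :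
    faceGaugeFun c d w = 1 ∨ faceGaugeFun c d w = -1 := by
  unfold faceGaugeFun
  split_ifs
  · exact hc _
  · exact hd _
  · exact Or.inl rfl

/-- **The local gauge around the plaquette `f`.** [folklore] -/
def faceGauge (f : Site 2) (c d : Fin 4 → ℝ) : MedialVertex → ℝ :=
  keyGauge fun x => faceGaugeFun c d (x - f - f)

/-- Bookkeeping (`faceGauge_cases`). [folklore] -/
theorem faceGauge_cases (f : Site 2) {c d : Fin 4 → ℝ} (hc : ∀ k, c k = 1 ∨ c k = -1) (hd : ∀ k, d k = 1 ∨ d k = -1)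
    (e : MedialVertex) : faceGauge f c d e = 1 ∨ faceGauge f c d e = -1 := by
  induction e using Sym2.ind with
  | h x y => simp only [faceGauge, keyGauge_mk]; exact faceGaugeFun_cases hc hd _

/-- The values of the face gauge on the eight bonds around `f`. [folklore] -/
theorem faceGauge_values (f : Site 2) (c d : Fin 4 → ℝ) (j : Fin 4) :
    faceGauge f c d (cSrc (f + cornerOff j, j)) = c j ∧ faceGauge f c d (cTgt (f + cornerOff j, j)) = c (j + 3) ∧
    faceGauge f c d (cSrc (f + cornerOff j, j + 3)) = d j ∧ faceGauge f c d (cTgt (f + cornerOff j, j + 3)) = c j := by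
  simp only [faceGauge, cSrc, cTgt, keyGauge_mk]
  refine ⟨?_, ?_, ?_, ?_⟩
  · rw [show f + cornerOff j + (f + cornerOff j + cornerUnit j) - f - f = faceSideOff j by rw [faceSideOff]; abel,
      faceGaugeFun_side]
  · rw [show f + cornerOff j + (f + cornerOff j + cornerUnit (j + 1)) - f - f = cornerOff j + cornerOff j + cornerUnit (j + 1) by abel,
      faceSideOff_prev, faceGaugeFun_side]
  · rw [show f + cornerOff j + (f + cornerOff j + cornerUnit (j + 3)) - f - f = faceOutOff j by rw [faceOutOff]; abel,
      faceGaugeFun_out]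
  · rw [show f + cornerOff j + (f + cornerOff j + cornerUnit (j + 3 + 1)) - f - f = cornerOff j + cornerOff j + cornerUnit (j + 3 + 1) by abel,
      faceSideOff_self, faceGaugeFun_side]

/-- **Lemma 3.8 at a plaquette for a section** (even parity of the seam corners of the plaquette):
`∑_j (Φ(v_j, j+3) - Φ(v_j, j)) ≥ 0`, i.e. `Δ H_b (f) ≥ 0` for any primitive. [cite: Smirnov2010, Lemma 3.8; ChelkakHonglerIzyurovAnnals2015, Remark 3.9] -/
theorem sum_faceStep_nonneg_of_compat (F : MedialVertex → ℂ) (f : Site 2) {t t' : Fin 4 → ℝ}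
    (hin : ∀ j, CompatAt F (f + cornerOff j, j) (t j)) (hout : ∀ j, CompatAt F (f + cornerOff j, j + 3) (t' j))
    (hpar : t 0 * t 1 * t 2 * t 3 = 1) :
    0 ≤ ∑ j : Fin 4, (cornerFlux F (f + cornerOff j, j + 3) - cornerFlux F (f + cornerOff j, j)) := by
  have ht := fun j => (hin j).pm
  have ht' := fun j => (hout j).pm
  -- the gauge data: `c 0 = 1`, `c 3 = t 0`, `c 2 = t 0 t 3`, `c 1 = t 0 t 3 t 2`
  obtain ⟨c, hc⟩ : ∃ c : Fin 4 → ℝ, c = ![1, t 0 * t 3 * t 2, t 0 * t 3, t 0] := ⟨_, rfl⟩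
  have c0 : c 0 = 1 := by rw [hc]; rfl
  have c1 : c 1 = t 0 * t 3 * t 2 := by rw [hc]; rfl
  have c2 : c 2 = t 0 * t 3 := by rw [hc]; rfl
  have c3 : c 3 = t 0 := by rw [hc]; rfl
  have hcpm : ∀ k, c k = 1 ∨ c k = -1 := by
    intro k
    fin_cases k
    · exact Or.inl c0
    · rw [show c ⟨1, by norm_num⟩ = t 0 * t 3 * t 2 from c1]; exact pm_mul (pm_mul (ht 0) (ht 3)) (ht 2)
    · rw [show c ⟨2, by norm_num⟩ = t 0 * t 3 from c2]; exact pm_mul (ht 0) (ht 3)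
    · rw [show c ⟨3, by norm_num⟩ = t 0 from c3]; exact ht 0
  obtain ⟨d, hd⟩ : ∃ d : Fin 4 → ℝ, d = fun j => t' j * c j := ⟨_, rfl⟩
  have hdpm : ∀ k, d k = 1 ∨ d k = -1 := fun k => by rw [hd]; exact pm_mul (ht' k) (hcpm k)
  have q0 := pm_sq (ht 0)
  have q1 := pm_sq (ht 1)
  have q2 := pm_sq (ht 2)
  have q3 := pm_sq (ht 3)
  have hprod : ∀ j, c j * c (j + 3) = t j := by
    intro j
    fin_cases j
    · show c 0 * c 3 = t 0
      rw [c0, c3, one_mul]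
    · show c 1 * c 0 = t 1
      rw [c1, c0]; linear_combination (-(t 0 * t 3 * t 2)) * q1 + t 1 * hpar
    · show c 2 * c 1 = t 2
      rw [c2, c1]; linear_combination (t 2 * t 3 * t 3) * q0 + t 2 * q3
    · show c 3 * c 2 = t 3
      rw [c3, c2]; linear_combination t 3 * q0
  have hprod' : ∀ j, d j * c j = t' j := by
    intro j; rw [hd]; simp only; rw [mul_assoc, pm_sq (hcpm j), mul_one]
  obtain ⟨χ, hχ⟩ : ∃ χ : MedialVertex → ℝ, χ = faceGauge f c d := ⟨_, rfl⟩
  have hχpm : ∀ e, χ e = 1 ∨ χ e = -1 := by rw [hχ]; exact faceGauge_cases f hcpm hdpm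
  have hvals := faceGauge_values f c d
  rw [← hχ] at hvals
  have hh : ∀ j, IsSHolAt (fun e => (χ e : ℂ) * F e) (f + cornerOff j, j) := by
    intro j
    refine CompatAt.gauge (hχpm _) (hχpm _) ?_
    rw [(hvals j).1, (hvals j).2.1, hprod j]; exact hin j
  have hh' : ∀ j, IsSHolAt (fun e => (χ e : ℂ) * F e) (f + cornerOff j, j + 3) := by
    intro j
    refine CompatAt.gauge (hχpm _) (hχpm _) ?_
    rw [(hvals j).2.2.1, (hvals j).2.2.2, hprod' j]; exact hout j
  have key := sum_faceStep_eq_norm_sq (fun e => (χ e : ℂ) * F e) f hh hh'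
  have hsum : ∑ j : Fin 4, (cornerFlux F (f + cornerOff j, j + 3) - cornerFlux F (f + cornerOff j, j)) =
      ∑ j : Fin 4, (cornerFlux (fun e => (χ e : ℂ) * F e) (f + cornerOff j, j + 3) -
        cornerFlux (fun e => (χ e : ℂ) * F e) (f + cornerOff j, j)) := by
    refine Finset.sum_congr rfl fun j _ => ?_
    rw [cornerFlux_sign_mul (hχpm _), cornerFlux_sign_mul (hχpm _)]
  rw [hsum, key]
  exact sq_nonneg _

/-! ### Closedness of the flux form and the signs of the Laplacian of a primitive pair -/

/-- **The fluxes of a section add up around every medial vertex** (Lemma 3.6), given compatibility at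
the two arriving corners. [cite: Smirnov2010, Lemma 3.6] -/
theorem cornerFlux_cycle_of_compat (F : MedialVertex → ℂ) (u : Site 2) (k : Fin 4) {s₁ s₂ : ℝ}
    (h₁ : CompatAt F (u, k + 3) s₁) (h₂ : CompatAt F (u + cornerUnit k, k + 1) s₂) :
    cornerFlux F (u, k) + cornerFlux F (u + cornerUnit k, k + 2) =
      cornerFlux F (u + cornerUnit k, k + 1) + cornerFlux F (u, k + 3) := by
  rw [h₁.cornerFlux_eq, h₂.cornerFlux_eq]
  simp only [cornerFlux, cFace]
  rw [cTgt_add_three, cTgt_add_cornerUnit_succ, cSrc_add_cornerUnit_add_two,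
    norm_projLine_sq_add_two, show k + 3 = k + 1 + 2 by fin_cases k <;> rfl, norm_projLine_sq_add_two]

/-- **The flux form of a section is closed** on a face set around whose interior edges the section
is compatible (s-holomorphic or anti) at the two arriving corners. [cite: Smirnov2010, proof of Lemma 3.6] -/
theorem isCornerClosedOn_cornerFlux_of_compat (F : MedialVertex → ℂ) (Φ : Set (Site 2))
    (h : ∀ (u : Site 2) (k : Fin 4), faceAt u k ∈ Φ → faceAt u (k + 3) ∈ Φ →
      (∃ s₁, CompatAt F (u, k + 3) s₁) ∧ (∃ s₂, CompatAt F (u + cornerUnit k, k + 1) s₂)) :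
    IsCornerClosedOn (cornerFlux F) Φ := by
  intro u k h₁ h₂
  obtain ⟨⟨s₁, hs₁⟩, ⟨s₂, hs₂⟩⟩ := h u k h₁ h₂
  exact cornerFlux_cycle_of_compat F u k hs₁ hs₂

namespace IsPrimitivePair

variable {F : MedialVertex → ℂ} {Hw Hb : Site 2 → ℝ} {Q : Set (Site 2 × Fin 4)}

/-- **`Δ Hw (u) ≤ 0` for a primitive pair of a section** with sign data of even parity around `u`. [cite: Smirnov2010, Lemma 3.8; ChelkakHonglerIzyurovAnnals2015, Remark 3.9] -/
theorem latticeLaplacian_white_nonpos_of_compat (h : IsPrimitivePair F Hw Hb Q) (u : Site 2)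
    (hQ : ∀ k : Fin 4, (u, k) ∈ Q ∧ (u + cornerUnit k, k + 1) ∈ Q) {s s' : Fin 4 → ℝ}
    (hin : ∀ k, CompatAt F (u, k) (s k)) (hout : ∀ k, CompatAt F (u + cornerUnit k, k + 1) (s' k))
    (hpar : s 0 * s 1 * s 2 * s 3 = 1) :
    latticeLaplacian Hw u ≤ 0 := by
  rw [latticeLaplacian]
  calc ∑ k : Fin 4, (Hw (u + cornerUnit k) - Hw u)
      = ∑ k : Fin 4, (cornerFlux F (u, k) - cornerFlux F (u + cornerUnit k, k + 1)) :=
        Finset.sum_congr rfl fun k _ => h.white_increment u k (hQ k).1 (hQ k).2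
    _ ≤ 0 := sum_vertexStep_nonpos_of_compat F u hin hout hpar

/-- **`Δ Hb (f) ≥ 0` for a primitive pair of a section** with sign data of even parity around the
plaquette `f`. [cite: Smirnov2010, Lemma 3.8; ChelkakHonglerIzyurovAnnals2015, Remark 3.9] -/
theorem latticeLaplacian_black_nonneg_of_compat (h : IsPrimitivePair F Hw Hb Q) (f : Site 2)
    (hQ : ∀ j : Fin 4, (f + cornerOff j, j) ∈ Q ∧ (f + cornerOff j, j + 3) ∈ Q) {t t' : Fin 4 → ℝ}
    (hin : ∀ j, CompatAt F (f + cornerOff j, j) (t j)) (hout : ∀ j, CompatAt F (f + cornerOff j, j + 3) (t' j))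
    (hpar : t 0 * t 1 * t 2 * t 3 = 1) :
    0 ≤ latticeLaplacian Hb f := by
  rw [latticeLaplacian]
  have e : ∑ k : Fin 4, (Hb (f + cornerUnit k) - Hb f) =
      ∑ j : Fin 4, (cornerFlux F (f + cornerOff j, j + 3) - cornerFlux F (f + cornerOff j, j)) := by
    symm
    exact Fintype.sum_equiv (Equiv.addRight (3 : Fin 4)) _ _
      fun j => (h.black_increment f j (hQ j).1 (hQ j).2).symm
  rw [e]
  exact sum_faceStep_nonneg_of_compat F f hin hout hpar

end IsPrimitivePair

end Literature.Probability.LatticeModels
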